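import Mathlib.Analysis.ODE.Gronwall
import Mathlib.Analysis.Calculus.Deriv.MeanValue
import Mathlib.Analysis.Calculus.Deriv.Prod
import Literature.Analysis.ODE.MaximalTime
import HarnessLib

/-!
# Component-wise perturbation (deviation) bounds for linear differential inequalities

Topic `Literature/Analysis/ODE`. The COMPONENT-WISE comparison lemma behind rigorous integration
of perturbed ODEs / differential inclusions (Kapela–Zgliczyński 2009, §4 Lemma 8 and Thm. 9, the
case of one-dimensional blocks, where the logarithmic norm of a `1 × 1` block `a` is `a` itself):

* `abs_le_gronwallBound_of_coeff_le` (one component). If `u : [0, s] → ℝ` has a right derivative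
  `u'` with `|u' t - a_t · u t| ≤ β` for SOME coefficient `a_t ≤ d` at every `t` (no regularity of
  `t ↦ a_t` is needed, and `a_t` is bounded from ABOVE only), and `|u 0| ≤ η`, then
  `|u t| ≤ gronwallBound η d β t = η e^{d t} + β ∫₀ᵗ e^{d r} dr`. This is the scalar
  variation-of-constants bound with a sign-indefinite coefficient (`d < 0` allowed: dissipative
  directions contract), proved by the boundary-function comparison of Mathlib
  (`image_le_of_deriv_right_lt_deriv_boundary'`) applied to `u` and `-u` against the
  `ε`-inflated bound, then `ε → 0`.
* `abs_le_of_componentwisePerturbation` (the system). Let `y : [0, h] → ℝ^ι`, `y 0 = 0`, have a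
  right derivative `y'` with, for every `t` and `i`, a coefficient `a ≤ dᵢ` such that
  `|y'ᵢ t - a · yᵢ t| ≤ Σⱼ Rᵢⱼ |yⱼ t| + gᵢ` (`R ≥ 0`, `g ≥ 0`; i.e. `y' = A(t) y + δ(t)` with
  `Aᵢᵢ ≤ dᵢ`, `|Aᵢⱼ| ≤ Rᵢⱼ`, `|δᵢ| ≤ gᵢ`). If `Z > 0` satisfies the computable fixed-point
  inequality `(R Z + g)ᵢ · Eᵢ ≤ Zᵢ` with `Eᵢ ≥ ∫₀ʰ e^{dᵢ r} dr`, then for all `t ∈ [0, h]`,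
  `|yᵢ t| ≤ (R Z + g)ᵢ ∫₀ᵗ e^{dᵢ r} dr ≤ (R Z + g)ᵢ Eᵢ =: Dᵢ ≤ Zᵢ`. (Kapela–Zgliczyński bound
  `|y| ≤` the solution of the Metzler comparison system `w' = (diag d + R) w + g`, `w 0 = 0`;
  `t ↦ (R Z + g) ∘ ∫₀ᵗ e^{d r} dr` is a supersolution of that system as long as it stays `≤ Z`, which
  the fixed-point inequality guarantees — so no matrix exponential is needed. Proof here: bootstrap
  on the a priori bound `|y| ≤ Z` (first-exit argument, `Literature.Analysis.ODE.maximalTimeP`) and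
  the one-component lemma with `β = (R Z + g)ᵢ`.)

This is the "deviation lemma" of a dissipative-PDE integration step (modes `x = x₂ + y` where `x₂`
is the unperturbed Galerkin flow and `A(t) = ∫₀¹ Df(x₂ + σ y) dσ` over a box): it supplies the
defect box `[-D, D]` added to the unperturbed enclosure, and hence hypothesis `H1` of
`Literature.Analysis.ODE.tailIsolation_step`.

## References

* T. Kapela, P. Zgliczyński, *A Lohner-type algorithm for control systems and ordinary differential
  inclusions*, Discrete Contin. Dyn. Syst. B 11 (2009) 365–385, arXiv:0712.0910, §4 (Lemma 8,
  Theorem 9). [KapelaZgliczynski2009]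
* P. Zgliczyński, *Attracting fixed points for the Kuramoto–Sivashinsky equation*, SIAM J. Appl.
  Dyn. Syst. 1 (2002), §4–§6 (component-wise estimates in the dissipative algorithm). [Zgliczynski2002]
-/

noncomputable section

open Set Real Filter Topology

namespace Literature.Analysis.ODE

/-! ### The comparison function `t ↦ ∫₀ᵗ e^{K r} dr = gronwallBound 0 K 1 t` -/

/-- `gronwallBound δ K ε x = δ e^{K x} + ε · gronwallBound 0 K 1 x` (affine in `(δ, ε)`).
[folklore] -/
private theorem gronwallBound_eq_add (δ K ε x : ℝ) :
    gronwallBound δ K ε x = δ * exp (K * x) + ε * gronwallBound 0 K 1 x := by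
  by_cases hK : K = 0
  · subst hK
    simp [gronwallBound_K0]
  · simp only [gronwallBound_of_K_ne_0 hK]
    ring

/-- `K · ∫₀ˣ e^{K r} dr + 1 = e^{K x}`. [folklore] -/
private theorem gronwallBound_mul_add_one (K x : ℝ) :
    K * gronwallBound 0 K 1 x + 1 = exp (K * x) := by
  by_cases hK : K = 0
  · subst hK
    simp [gronwallBound_K0]
  · simp only [gronwallBound_of_K_ne_0 hK]
    field_simp
    ring

/-- `d/dx ∫₀ˣ e^{K r} dr = e^{K x}`. [folklore] -/
private theorem hasDerivAt_gronwallBound_one (K x : ℝ) :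
    HasDerivAt (gronwallBound 0 K 1) (exp (K * x)) x :=
  (hasDerivAt_gronwallBound 0 K 1 x).congr_deriv (gronwallBound_mul_add_one K x)

/-- `x ↦ ∫₀ˣ e^{K r} dr` is strictly increasing. [folklore] -/
private theorem strictMono_gronwallBound_one (K : ℝ) : StrictMono (gronwallBound 0 K 1) :=
  strictMono_of_deriv_pos fun x => by
    rw [(hasDerivAt_gronwallBound_one K x).deriv]
    exact exp_pos _

/-- `∫₀ˣ e^{K r} dr ≥ 0` for `x ≥ 0`. [folklore] -/
private theorem gronwallBound_one_nonneg (K : ℝ) {x : ℝ} (hx : 0 ≤ x) :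
    0 ≤ gronwallBound 0 K 1 x := by
  have h := (strictMono_gronwallBound_one K).monotone hx
  rwa [gronwallBound_x0] at h

/-! ### One component: Gronwall with a coefficient bounded from above only -/

/-- **Scalar deviation bound with a one-sided coefficient** (Kapela–Zgliczyński 2009, Lemma 8 for
a single one-dimensional block). Let `u` be continuous on `[0, s]` with right derivative `u' t`
on `[0, s)`, `|u 0| ≤ η`, `β ≥ 0`, and suppose that at every `t ∈ [0, s)` there is a coefficient
`a ≤ d` with `|u' t - a · u t| ≤ β`. Then `|u t| ≤ gronwallBound η d β t`
(`= η e^{d t} + (β/d)(e^{d t} - 1)`, resp. `η + β t` for `d = 0`) for all `t ∈ [0, s]`.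
[cite: KapelaZgliczynski2009, §4 Lemma 8] -/
theorem abs_le_gronwallBound_of_coeff_le {u u' : ℝ → ℝ} {s d β η : ℝ}
    (huc : ContinuousOn u (Icc 0 s)) (hu : ∀ t ∈ Ico 0 s, HasDerivWithinAt u (u' t) (Ici t) t)
    (hη : |u 0| ≤ η) (hβ : 0 ≤ β) (bound : ∀ t ∈ Ico 0 s, ∃ a ≤ d, |u' t - a * u t| ≤ β)
    {t : ℝ} (ht : t ∈ Icc 0 s) : |u t| ≤ gronwallBound η d β t := by
  -- `ε`-inflated comparison function
  have key : ∀ ε, 0 < ε → |u t| ≤ gronwallBound (η + ε) d (β + ε) t := by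
    intro ε hε
    set B := gronwallBound (η + ε) d (β + ε) with hB_def
    have hBc : ContinuousOn B (Icc 0 s) := fun x _ =>
      (hasDerivAt_gronwallBound _ _ _ x).continuousAt.continuousWithinAt
    have hB' : ∀ x ∈ Ico 0 s, HasDerivWithinAt B (d * B x + (β + ε)) (Ici x) x := fun x _ =>
      (hasDerivAt_gronwallBound _ _ _ x).hasDerivWithinAt
    have hBpos : ∀ x, 0 ≤ x → 0 < B x := by
      intro x hx
      rw [hB_def, gronwallBound_eq_add]
      have h1 : 0 < (η + ε) * exp (d * x) := by
        have : 0 ≤ η := (abs_nonneg _).trans hη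
        positivity
      have h2 : 0 ≤ (β + ε) * gronwallBound 0 d 1 x :=
        mul_nonneg (by linarith) (gronwallBound_one_nonneg d hx)
      linarith
    have hB0 : B 0 = η + ε := gronwallBound_x0 _ _ _
    -- `u ≤ B`
    have hup : ∀ x ∈ Icc 0 s, u x ≤ B x := by
      refine fun x hx => image_le_of_deriv_right_lt_deriv_boundary' huc hu
        (by rw [hB0]; linarith [le_abs_self (u 0)]) hBc hB' (fun x hx hxB => ?_) hx
      obtain ⟨a, had, hab⟩ := bound x hx
      have hux : 0 < u x := hxB ▸ hBpos x hx.1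
      have h1 : u' x ≤ a * u x + β := by linarith [(abs_le.1 hab).2]
      have h2 : a * u x ≤ d * u x := mul_le_mul_of_nonneg_right had hux.le
      rw [← hxB]
      linarith
    -- `-u ≤ B`
    have hlo : ∀ x ∈ Icc 0 s, -u x ≤ B x := by
      refine fun x hx => image_le_of_deriv_right_lt_deriv_boundary' (f := fun t => -u t)
        (f' := fun t => -u' t) huc.neg (fun t ht => (hu t ht).neg)
        (by simp only [hB0]; linarith [neg_abs_le (u 0)]) hBc hB' (fun x hx hxB => ?_) hx
      obtain ⟨a, had, hab⟩ := bound x hx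
      have hxB' : -u x = B x := hxB
      have hux : 0 < -u x := hxB' ▸ hBpos x hx.1
      have h1 : -u' x ≤ a * (-u x) + β := by linarith [(abs_le.1 hab).1]
      have h2 : a * (-u x) ≤ d * (-u x) := mul_le_mul_of_nonneg_right had hux.le
      show -u' x < d * B x + (β + ε)
      rw [← hxB']
      linarith
    exact abs_le.2 ⟨by linarith [hlo t ht], hup t ht⟩
  -- let `ε → 0`
  have hG := gronwallBound_one_nonneg d ht.1
  refine le_of_forall_pos_lt_add fun ε' hε' => ?_
  set c := exp (d * t) + gronwallBound 0 d 1 t + 1 with hc_def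
  have hc0 : 0 < c := by have := exp_pos (d * t); linarith
  have h := key (ε' / c) (div_pos hε' hc0)
  rw [gronwallBound_eq_add] at h
  rw [gronwallBound_eq_add]
  have hlt : ε' / c * (exp (d * t) + gronwallBound 0 d 1 t) < ε' := by
    rw [div_mul_eq_mul_div, div_lt_iff₀ hc0]
    exact mul_lt_mul_of_pos_left (by linarith) hε'
  calc |u t| ≤ (η + ε' / c) * exp (d * t) + (β + ε' / c) * gronwallBound 0 d 1 t := h
    _ = η * exp (d * t) + β * gronwallBound 0 d 1 t
        + ε' / c * (exp (d * t) + gronwallBound 0 d 1 t) := by ring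
    _ < η * exp (d * t) + β * gronwallBound 0 d 1 t + ε' := by linarith

/-! ### The system: component-wise bound under the fixed-point inequality `E ∘ (R Z + g) ≤ Z` -/

/-- **Component-wise perturbation bound** (Kapela–Zgliczyński 2009, §4 Lemma 8 / Thm. 9, with the
computable supersolution `(R Z + g) ∘ ∫₀ᵗ e^{d r} dr` of the Metzler comparison system). Let
`y : [0, h] → ℝ^ι` be continuous with right derivative `y'`, `y 0 = 0`, and suppose that for every
`t ∈ [0, h)` and every `i` there is `a ≤ dᵢ` with `|y'ᵢ t - a · yᵢ t| ≤ Σⱼ Rᵢⱼ |yⱼ t| + gᵢ`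
(`R ≥ 0`, `g ≥ 0`). If `Z > 0`, `Eᵢ ≥ gronwallBound 0 dᵢ 1 h = ∫₀ʰ e^{dᵢ r} dr` and
`((R Z)ᵢ + gᵢ) · Eᵢ ≤ Zᵢ` for all `i`, then for all `t ∈ [0, h]` and all `i`,
`|yᵢ t| ≤ ((R Z)ᵢ + gᵢ) · ∫₀ᵗ e^{dᵢ r} dr`.
[cite: KapelaZgliczynski2009, §4 Lemma 8, Thm. 9] -/
theorem abs_le_of_componentwisePerturbation {ι : Type*} [Fintype ι] {y y' : ℝ → ι → ℝ}
    {d g Z E : ι → ℝ} {R : ι → ι → ℝ} {h : ℝ} (hh : 0 ≤ h)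
    (hyc : ContinuousOn y (Icc 0 h)) (hy : ∀ t ∈ Ico 0 h, HasDerivWithinAt y (y' t) (Ici t) t)
    (hy0 : y 0 = 0) (hR : ∀ i j, 0 ≤ R i j) (hg : ∀ i, 0 ≤ g i) (hZ0 : ∀ i, 0 < Z i)
    (hfield : ∀ t ∈ Ico 0 h, ∀ i, ∃ a ≤ d i,
      |y' t i - a * y t i| ≤ (∑ j, R i j * |y t j|) + g i)
    (hE : ∀ i, gronwallBound 0 (d i) 1 h ≤ E i)
    (hZ : ∀ i, ((∑ j, R i j * Z j) + g i) * E i ≤ Z i) {t : ℝ} (ht : t ∈ Icc 0 h) (i : ι) :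
    |y t i| ≤ ((∑ j, R i j * Z j) + g i) * gronwallBound 0 (d i) 1 t := by
  obtain ⟨β, hβ_def⟩ : ∃ β : ι → ℝ, ∀ i, β i = (∑ j, R i j * Z j) + g i := ⟨_, fun _ => rfl⟩
  have hβ : ∀ i, 0 ≤ β i := fun i => by
    rw [hβ_def]
    exact add_nonneg (Finset.sum_nonneg fun j _ => mul_nonneg (hR i j) (hZ0 j).le) (hg i)
  have hZ' : ∀ i, β i * E i ≤ Z i := fun i => by rw [hβ_def]; exact hZ i
  rw [← hβ_def i]
  -- the a priori bound to be bootstrapped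
  let P : ℝ → Prop := fun s => ∀ i, |y s i| ≤ Z i
  have hP0 : P 0 := fun i => by simp [hy0, (hZ0 i).le]
  have hyi : ∀ i, ContinuousOn (fun u => y u i) (Icc 0 h) := fun i =>
    (continuous_apply i).comp_continuousOn hyc
  -- on an interval where `P` holds, the one-component lemma applies with `β = R Z + g`
  have key : ∀ S ∈ Icc 0 h, (∀ s ∈ Icc 0 S, P s) →
      ∀ s ∈ Icc 0 S, ∀ i, |y s i| ≤ β i * gronwallBound 0 (d i) 1 s := by
    intro S hS hPS s hs i
    have hb := abs_le_gronwallBound_of_coeff_le (u := fun t => y t i) (u' := fun t => y' t i)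
      (s := S) (d := d i) (β := β i) (η := 0)
      ((hyi i).mono (Icc_subset_Icc_right hS.2))
      (fun t ht => hasDerivWithinAt_pi.1 (hy t ⟨ht.1, ht.2.trans_le hS.2⟩) i)
      (by simp [hy0]) (hβ i)
      (fun t ht => by
        obtain ⟨a, had, hab⟩ := hfield t ⟨ht.1, ht.2.trans_le hS.2⟩ i
        refine ⟨a, had, hab.trans ?_⟩
        have hPt := hPS t (Ico_subset_Icc_self ht)
        rw [hβ_def]
        exact add_le_add
          (Finset.sum_le_sum fun j _ => mul_le_mul_of_nonneg_left (hPt j) (hR i j)) le_rfl) hs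
    rw [gronwallBound_eq_add] at hb
    simpa using hb
  -- closedness of `P` under limits from the left
  have hclosed : ∀ s ∈ Ioc 0 h, (∀ u ∈ Ico 0 s, P u) → P s := by
    intro s hs hPu i
    by_contra hcon
    have hlt : Z i < |y s i| := lt_of_not_ge hcon
    have hcont : ContinuousWithinAt (fun u => |y u i|) (Icc 0 h) s :=
      (continuous_abs.continuousAt).comp_continuousWithinAt ((hyi i) s ⟨hs.1.le, hs.2⟩)
    rw [Metric.continuousWithinAt_iff] at hcont
    obtain ⟨δ, hδ, hδc⟩ := hcont (|y s i| - Z i) (by linarith)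
    set u := max 0 (s - δ / 2) with hu_def
    have hu0 : 0 ≤ u := le_max_left _ _
    have hus : u < s := max_lt hs.1 (by linarith)
    have hud : dist u s < δ := by
      rw [Real.dist_eq, abs_of_nonpos (by linarith)]
      have : s - δ / 2 ≤ u := le_max_right _ _
      linarith
    have h1 := hδc (x := u) ⟨hu0, hus.le.trans hs.2⟩ hud
    rw [Real.dist_eq] at h1
    have h2 : |y u i| ≤ Z i := hPu u ⟨hu0, hus⟩ i
    have h3 := (abs_lt.mp h1).1
    linarith
  -- the maximal time of validity of `P` is `h`
  set T := maximalTimeP P 0 h with hT_def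
  have hT : T ∈ Icc 0 h := maximalTimeP_mem hh hP0
  have hPT : ∀ s ∈ Icc 0 T, P s := fun s hs => maximalTimeP_spec hh hP0 hclosed hs
  have hTh : T = h := by
    by_contra hne
    have hlt : T < h := lt_of_le_of_ne hT.2 hne
    -- at `T` the a priori bound holds STRICTLY (`Z > 0`, `∫₀ᵀ < ∫₀ʰ ≤ E`)
    have hstrict : ∀ i, |y T i| < Z i := fun i => by
      have hb := key T hT hPT T ⟨hT.1, le_rfl⟩ i
      rcases (hβ i).eq_or_lt with h0 | hpos
      · rw [← h0, zero_mul] at hb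
        exact hb.trans_lt (hZ0 i)
      · have hm : gronwallBound 0 (d i) 1 T < gronwallBound 0 (d i) 1 h :=
          strictMono_gronwallBound_one (d i) hlt
        have h1 := mul_lt_mul_of_pos_left hm hpos
        have h2 : β i * gronwallBound 0 (d i) 1 h ≤ β i * E i :=
          mul_le_mul_of_nonneg_left (hE i) hpos.le
        linarith [hZ' i]
    have hev : ∀ᶠ s in 𝓝[Icc 0 h] T, P s := by
      have hj : ∀ i, ∀ᶠ s in 𝓝[Icc 0 h] T, |y s i| < Z i := fun i => by
        have hcont : ContinuousWithinAt (fun u => |y u i|) (Icc 0 h) T :=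
          (continuous_abs.continuousAt).comp_continuousWithinAt ((hyi i) T hT)
        exact hcont.eventually_mem (Iio_mem_nhds (hstrict i))
      filter_upwards [eventually_all.2 hj] with s hs i using (hs i).le
    exact not_eventually_of_maximalTimeP_lt hh hP0 hlt hev
  have hPh : ∀ s ∈ Icc 0 h, P s := fun s hs => hPT s (hTh ▸ hs)
  exact key h ⟨hh, le_rfl⟩ hPh t ht i

/-- **Component-wise perturbation bound, uniform form**: under the hypotheses of
`abs_le_of_componentwisePerturbation`, `|yᵢ t| ≤ Dᵢ := ((R Z)ᵢ + gᵢ) · Eᵢ` and `Dᵢ ≤ Zᵢ` on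
`[0, h]` — the defect box `[-D, D]` of a dissipative integration step.
[cite: KapelaZgliczynski2009, §4 Thm. 9] -/
theorem abs_le_of_componentwisePerturbation_uniform {ι : Type*} [Fintype ι] {y y' : ℝ → ι → ℝ}
    {d g Z E : ι → ℝ} {R : ι → ι → ℝ} {h : ℝ} (hh : 0 ≤ h)
    (hyc : ContinuousOn y (Icc 0 h)) (hy : ∀ t ∈ Ico 0 h, HasDerivWithinAt y (y' t) (Ici t) t)
    (hy0 : y 0 = 0) (hR : ∀ i j, 0 ≤ R i j) (hg : ∀ i, 0 ≤ g i) (hZ0 : ∀ i, 0 < Z i)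
    (hfield : ∀ t ∈ Ico 0 h, ∀ i, ∃ a ≤ d i,
      |y' t i - a * y t i| ≤ (∑ j, R i j * |y t j|) + g i)
    (hE : ∀ i, gronwallBound 0 (d i) 1 h ≤ E i)
    (hZ : ∀ i, ((∑ j, R i j * Z j) + g i) * E i ≤ Z i) {t : ℝ} (ht : t ∈ Icc 0 h) (i : ι) :
    |y t i| ≤ ((∑ j, R i j * Z j) + g i) * E i ∧ ((∑ j, R i j * Z j) + g i) * E i ≤ Z i := by
  have hb := abs_le_of_componentwisePerturbation hh hyc hy hy0 hR hg hZ0 hfield hE hZ ht i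
  have hβ : 0 ≤ (∑ j, R i j * Z j) + g i :=
    add_nonneg (Finset.sum_nonneg fun j _ => mul_nonneg (hR i j) (hZ0 j).le) (hg i)
  have hm : gronwallBound 0 (d i) 1 t ≤ E i :=
    ((strictMono_gronwallBound_one (d i)).monotone ht.2).trans (hE i)
  exact ⟨hb.trans (mul_le_mul_of_nonneg_left hm hβ), hZ i⟩

end Literature.Analysis.ODE

end
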